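import Literature.NumberTheory.EllipticCurves.Kato2004.KummerCupLevelClass
import Literature.NumberTheory.EllipticCurves.Kato2004.IwasawaH1NumberFieldTowerLimitProofs
import Literature.NumberTheory.EllipticCurves.Kato2004.IntegralH1CorestrictionMackey
import Literature.NumberTheory.EllipticCurves.Kato2004.EllipticZetaBodyIsogenyTransport
import Literature.NumberTheory.GaloisRepresentations.ContinuousCorestrictionComp
import HarnessLib

/-!
# Kato 2004 (Astérisque 295) (15.6.1)∘(15.12.1) OVER THE CYCLOTOMIC `ℤ_p`-TOWER OF A NUMBER FIELD `K` — the TOWER brick: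
# from a Kummer frame `(V_s, ζ_k, e_k)` and a unit tower `(z_s)` to the doubly compatible integral family
# `c_{n,k} = cor_{V_s → Gal(K̄/K_n)}(κ_{V_s}(z_s^{1/p^k}) ∪ e_k) ∈ H¹(O_{K_n}[1/p], E[p^k])` and its UNIQUE glueing
in `𝐇¹_{K,Γ}(T_pE)`

Topic `NumberTheory/EllipticCurves`, sub-directory `Kato2004` (namespace = path).  ONE structure (explicit tower binders, all
hypotheses carried as fields — planner ruling D1019 Q3 «binders as HYPOTHESES, never silent»), definitions with bodies,
theorems: **no named fact is introduced** (D-0026); no instance, no notation, no `sorry`.  Number field `K`, ANY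
`E : WeierstrassCurve K`, ANY prime `p`, ANY `ℤ_p`-extension `κ`; NO complex multiplication inside — the CM input (which tower,
which units, why the levels fix `ζ_k`, `e_k`, why the norm relation holds) is supplied by the consumer as a term of
the structure.

Kato §15.5–15.6 (p. 253): the elliptic units `_𝔞z_{p^n𝔣} ∈ O_{K(p^n𝔣)}[1/p]^×` are norm-compatible ("the norm map of
`K(p^{n+1}𝔣)/K(p^n𝔣)` sends `_𝔞z_{p^{n+1}𝔣}` to `_𝔞z_{p^n𝔣}`") and define, through Kummer theory `𝕌 ≅ 𝐇¹(ℤ_p(1))` (15.6.1), an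
element of `𝐇¹ = lim_{K'} H¹(O_{K'}[1/p], ·)`; (15.12.1) (p. 263) twists to `𝐇¹(T)` and 15.14 reads it over `K ∩
ℚ(ζ_{p^∞})`.  At
finite level `(n, k)` this is: Kummer class of a `p^k`-th root of `z_s` on `V_s = Gal(K̄/K(p^s𝔣))` (T1a
`muSubgroupKummerClass`),
twisted by `ζ_k^a ↦ a e_k` (T1b-1 `kummerCupLevelClass`), corestricted to `Gal(K̄/K_n) ⊇ V_s` (`CM.layerCores`), for any `s`
large enough — independent of `s` by `cor ∘ κ = κ ∘ N` and the norm relation; compatible in `n` (transitivity of `cor`),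
in `k` (`p_*`, the level-change square of T1b-1) and integral (Mackey, `coresLe_mem_integralH1K_of_le`); hence, by
`𝐇¹_{K,Γ}(T_pE) = lim←_{n,k} H¹(O_{K_n}[1/p], E[p^k])` (T2b-2 `IwasawaH1DataOver.existsUnique_of_compatible`), ONE
element of the
pinned Iwasawa cohomology.

* §0 `CM.layerCores_trans` (transitivity of the `K`-side trace maps, `coresLe_comp`).
* §1 ★ `structure KummerCupTower E p κ` — fields: Kummer levels `V s` (open, decreasing), units `z s` fixed by `V s`, primitive
  roots `ζ k` (order `p^k`, `ζ (k+1)^p = ζ k`), torsion points `e k ∈ E[p^k]` (`p • e (k+1) = e k`), (b1) `V s` fixes `ζ k`,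
  `e k` for `k ≤ s`, (b2) `V (n+1) ≤ Gal(K̄/K_n)`, (b4) the norm relation `∏_{x ∈ V_s/V_{s+1}} t(x)·z_{s+1} = z_s`
(coset-product
  currency of `KummerCorestrictionNorm`), (b5) `p^m z_s ∈ ℤ̄_K` outside every `𝔓 ∤ p` (`z_s ∈ O[1/p]^×`); API `V_anti`,
  `V_le_layer`, `root`/`root_pow`, `levelClass`.
* §2 independence of the Kummer level: `layerCores_levelClass_succ`, `layerCores_levelClass_add`; ★ `cycClass D n k ∈
  H¹(Gal(K̄/K_n), E[p^k])` and `cycClass_eq_layerCores_levelClass` (any admissible `s`).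
* §3 ★ compatibilities `layerCoresOver_cycClass` (in `n`), `reduceTorsionH1_cycClass` (in `k`), ★ `cycClass_mem_integralH1K`.
* §4 ★★ `KummerCupTower.existsUnique_iwasawaClass (D) (IK : IwasawaH1DataOver E p κ γ) :
  ∃! x : IK.H, ∀ n k, reduceH1PkK E p k (κ.layerSubgroup n) (IK.proj n x) = D.cycClass n k` — Kato's Λ-adic class of the tower.

Dictionary `ℚ ↔ K`: none (the `ℚ`-side files `Kato2004/IwasawaH1*.lean` have no Kummer construction; the K-side reduction tower
is T2a/T2b).  GENERALISE-VS-DUPLICATE (director (729)): new notions = the two structures +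
`root`/`levelClass`/`classAt`/`level`/`cycClass`;
engines used BY NAME: `kummerCupLevelClass` & API (`Kato2004/KummerCupLevelClass.lean`), `subgroupKummerUnitsRoot`
(`GaloisRepresentations/SubgroupKummerMu.lean`), `CM.layerCores`/`CM.layerCores_eq_coresLe`/`layerCoresOver_eq_layerCores`,
`coresLe_comp`, `reduceTorsionH1_layerCoresK`/`reduceTorsionH1_eq_mapH1AddHomK` (T2b-2), `coresLe_mem_integralH1K_of_le`
(`IntegralH1CorestrictionMackey.lean`), `IwasawaH1DataOver.existsUnique_of_compatible` (T2b-2); nothing re-declared.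
CONSUMER BY NAME (director (721)/(739)(3)): the field `EU_not_mem_of_residue : GenusResidueNonzeroShape d → ¬ ∃ y ∈ frame.HS,
frame.EU 𝔞 = π • y` of `Summit.BirchSwinnertonDyer.Rank1Residual.Additive.GenusSeven.KatoGenusFrame`
(`RamifiedSevenGenusKatoShapes.lean`), read in the pinned frame `GenusSeven.PinnedKatoGenusFrame` as
`euK 𝔞 ∉ Set.range (IK.isogenyMap φ IK hγK)` (`RamifiedSevenGenusKatoPinnedFrame.lean`): the element `x` of §3 (at `p = 7`,
`K = ℚ(√−7)`, `V s = Gal(K̄/K(7^s𝔣))`, `z s = _𝔞z_{7^s𝔣}`) IS the Λ-adic elliptic-unit class `EU 𝔞` that this field constrains —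
stage S4 of the (C5) typing memo; S5 (`Kato2004/EllipticUnitKummerCupClass.lean`) names it and proves the `k = 1` layer formula.
HONEST FRAMING: Galois-cohomological bookkeeping; nothing about any particular curve, no CM theory, no value of any
L-function; no summit statement is proved.

## References

* [Kato2004Asterisque] K. Kato, Astérisque 295 (2004), §15.5 (p. 253: `𝕌`, `ℨ`, "the norm map of `K(p^{n+1}𝔣)/K(p^n𝔣)` sends
  `_𝔞z_{p^{n+1}𝔣}` to `_𝔞z_{p^n𝔣}`"), (15.6.1) (p. 253), §8.2 (pp. 180–181: `H¹(O_K[1/p], ·)`, `lim` over `n`), §12.2 (p. 220: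
  inverse limit w.r.t. trace maps), (15.12.1) (p. 263), 15.14 (p. 264).
* [Rubin2000] K. Rubin, *Euler Systems* (2000), III §3.3–3.4 (units ↦ classes in `H¹(K_n, ℤ_p(1))`, norm = corestriction
  compatibility), App. B Prop. B.2.3, §B.3.
* [NeukirchSchmidtWingberg2008] J. Neukirch, A. Schmidt, K. Wingberg (2008), I §5 Prop. 1.5.3 (iii) (transitivity of `cor`),
  (1.5.7) (cor and the norm).
* [deShalit1987] E. de Shalit, *Iwasawa Theory of Elliptic Curves with Complex Multiplication* (1987), II §2.5 Prop. (i)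
  (the norm relation of the Θ-values — the consumer's source for field `norm_z`), II §4.
-/

noncomputable section

open scoped NumberField
open Field IsDedekindDomain
open Literature.NumberTheory.GaloisRepresentations
open Literature.NumberTheory.EllipticCurves
open Literature.NumberTheory.EllipticCurves.Kato2004.CM (integralH1K mem_integralH1K_iff layerCores_eq_coresLe)
open WeierstrassCurve (geomPoints geomTorsion)

namespace Literature.NumberTheory.EllipticCurves.Kato2004

variable {K : Type} [Field K] [NumberField K]

/-! ## §0 Transitivity of the `K`-side trace maps -/

/-- **Transitivity of the trace maps `CM.layerCores`**: `Cor_{U'→U''} ∘ Cor_{U→U'} = Cor_{U→U''}` for open `U ≤ U' ≤ U''`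
(`coresLe_comp`, with the finiteness structures `CM.layerCores` chooses). [cite: NeukirchSchmidtWingberg2008, I §5
Prop. 1.5.3 (iii)] -/
theorem CM.layerCores_trans {A : Type} [CommRing A] [TopologicalSpace A] {M : Type} [AddCommGroup M] [Module A M]
    [TopologicalSpace M] [IsTopologicalAddGroup M] [ContinuousSMul A M] (T : GaloisRep K A M)
    {U U' U'' : Subgroup (absoluteGaloisGroup K)} (h : U ≤ U') (h' : U' ≤ U'')
    (hU : IsOpen (U : Set (absoluteGaloisGroup K))) (hU' : IsOpen (U' : Set (absoluteGaloisGroup K))) (c : H1 T U) :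
    CM.layerCores T h' hU' (CM.layerCores T h hU c) = CM.layerCores T (h.trans h') hU c := by
  haveI : CompactSpace (absoluteGaloisGroup K) := absoluteGaloisGroup_compactSpace K
  haveI : U.FiniteIndex := finiteIndex_of_isOpen_of_compactSpace _ hU
  haveI : U'.FiniteIndex := finiteIndex_of_isOpen_of_compactSpace _ hU'
  letI : Fintype (U' ⧸ U.subgroupOf U') := Fintype.ofFinite _
  letI : Fintype (U'' ⧸ U'.subgroupOf U'') := Fintype.ofFinite _
  letI : Fintype (U'' ⧸ U.subgroupOf U'') := Fintype.ofFinite _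
  rw [layerCores_eq_coresLe, layerCores_eq_coresLe, layerCores_eq_coresLe]
  have h1 := LinearMap.congr_fun (coresLe_comp T.toTopRep h h' hU hU') c
  rwa [LinearMap.comp_apply] at h1

/-! ## §1 Kummer towers -/

variable (E : WeierstrassCurve K) (p : ℕ) [Fact p.Prime]

/-- ★ **A Kummer frame for `E`, `p` over the number field `K`** — the `𝔞`-INDEPENDENT part of the EXPLICIT input of Kato's map
(15.6.1)∘(15.12.1)∘15.14 at finite levels: a decreasing sequence of open subgroups `V s ≤ Γ_K` (the Kummer levels; at the
consumer `V s = Gal(K̄/K(p^s𝔣))`), a compatible system of primitive `p^k`-th roots of unity `ζ k` (`ζ (k+1)^p = ζ k`) and of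
torsion points `e k ∈ E[p^k]` (`p • e (k+1) = e k`, i.e. an element of `T_pE` read levelwise — Kato's `γ`), such that (b1) `V s`
fixes `ζ k` and `e k` for `k ≤ s` (`μ_{p^k} ⊆ K(p^s𝔣)`, `K(E[p^k]) ⊆ K(p^s𝔣)` — the CM input, supplied by the consumer).
No field is a conclusion; all are hypotheses on the input, in the tree's vocabulary.
[cite: Kato2004Asterisque, §15.5 (p. 253), (15.6.1) (p. 253), (15.12.1) (p. 263)] -/
structure KummerFrame where
  /-- The Kummer levels `V s = Gal(K̄/K(p^s𝔣))`. -/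
  V : ℕ → Subgroup (absoluteGaloisGroup K)
  /-- Each level is open. -/
  isOpen_V : ∀ s, IsOpen (V s : Set (absoluteGaloisGroup K))
  /-- The levels decrease. -/
  V_succ_le : ∀ s, V (s + 1) ≤ V s
  /-- The chosen primitive `p^k`-th roots of unity. -/
  ζ : ℕ → (AlgebraicClosure K)ˣ
  /-- `ζ k` is a primitive `p^k`-th root of unity. -/
  isPrimitiveRoot_ζ : ∀ k, IsPrimitiveRoot (ζ k) (p ^ k)
  /-- Compatibility `ζ_{k+1}^p = ζ_k`. -/
  ζ_succ_pow : ∀ k, ζ (k + 1) ^ p = ζ k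
  /-- The chosen torsion points `e k ∈ E[p^k]` (an element of `T_pE`, levelwise). -/
  e : ∀ k, geomTorsion E ((p : ℤ) ^ k)
  /-- Compatibility `p • e_{k+1} = e_k`. -/
  e_succ : ∀ k, ((p : ℕ) : ℤ) • (e (k + 1) : geomPoints E) = e k
  /-- (b1) `V s` fixes `ζ k` for `k ≤ s` (`μ_{p^k} ⊆ K(p^s𝔣)`). -/
  smul_ζ : ∀ k s, k ≤ s → ∀ σ : V s, (σ : absoluteGaloisGroup K) • ζ k = ζ k
  /-- (b1) `V s` fixes `e k` for `k ≤ s` (`K(E[p^k]) ⊆ K(p^s𝔣)`, the CM input). -/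
  smul_e : ∀ k s, k ≤ s → ∀ σ : V s, (σ : absoluteGaloisGroup K) • e k = e k

namespace KummerFrame

variable {E p} (F : KummerFrame E p)

/-- ★ **A norm-compatible unit tower on a Kummer frame** — the `𝔞`-DEPENDENT part of the input (at the consumer: Kato's elliptic
units `z s = _𝔞z_{p^s𝔣}`, §15.5): units `z s ∈ K̄ˣ` fixed by `V s`, with (b4) the NORM RELATION in coset-product form
`∏_{x ∈ V_s/V_{s+1}} t(x)·z_{s+1} = z_s` for every section `t` (Kato §15.5 "the norm map of `K(p^{n+1}𝔣)/K(p^n𝔣)` sends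
`_𝔞z_{p^{n+1}𝔣}` to `_𝔞z_{p^n𝔣}`"; de Shalit II 2.5 (i)), and (b5) each `z s` a unit outside `p` up to a power of `p`
(`p^m z_s ∈ ℤ̄_K ∖ 𝔓` for all `𝔓 ∤ p`, i.e. `z_s ∈ O_{K(p^s𝔣)}[1/p]^×`).  All fields are hypotheses on the input.
[cite: Kato2004Asterisque, §15.5 (p. 253)] [cite: deShalit1987, II §2.5 Prop. (i)] -/
structure UnitTower where
  /-- The units `z s` (the elliptic units `_𝔞z_{p^s𝔣}`). -/
  z : ℕ → (AlgebraicClosure K)ˣ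
  /-- `z s` lies in the layer cut out by `V s`. -/
  smul_z : ∀ s (σ : F.V s), (σ : absoluteGaloisGroup K) • z s = z s
  /-- (b4) The norm relation `N_{s+1/s} z_{s+1} = z_s`, as a product over coset representatives. -/
  norm_z : ∀ (s : ℕ) [Fintype (F.V s ⧸ (F.V (s + 1)).subgroupOf (F.V s))]
    (t : F.V s ⧸ (F.V (s + 1)).subgroupOf (F.V s) → F.V s),
    (∀ x, (t x : F.V s ⧸ (F.V (s + 1)).subgroupOf (F.V s)) = x) →
      ∏ x, ((t x : F.V s) : absoluteGaloisGroup K) • z (s + 1) = z s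
  /-- (b5) `z s` is a `𝔓`-unit for every `𝔓 ∤ p`, up to a power of `p`. -/
  punit_z : ∀ s, ∃ (m : ℕ) (a : absIntegers (𝓞 K) K),
    (a : AlgebraicClosure K) = (p : AlgebraicClosure K) ^ m * (z s : AlgebraicClosure K) ∧
      ∀ v : HeightOneSpectrum (𝓞 K), ((p : ℕ) : 𝓞 K) ∉ v.asIdeal → ∀ 𝔓 ∈ v.primesAbove, a ∉ 𝔓

omit [NumberField K] [Fact (Nat.Prime p)] in
/-- The levels decrease: `V s' ≤ V s` for `s ≤ s'`. [cite: Kato2004Asterisque, §15.5 (p. 253)] -/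
theorem V_anti {s s' : ℕ} (h : s ≤ s') : F.V s' ≤ F.V s := by
  induction s', h using Nat.le_induction with
  | base => exact le_rfl
  | succ s' _ ih => exact (F.V_succ_le s').trans ih

variable (u : F.UnitTower)

/-- A chosen `p^k`-th root `z_s^{1/p^k}`, as a Kummer unit of `V s` (`subgroupKummerUnitsRoot`; every class below is
independent of the choice). [cite: Kato2004Asterisque, (15.6.1) (p. 253)] -/
def root (s k : ℕ) : subgroupKummerUnits K (p ^ k) (F.V s) :=
  haveI : NeZero (p ^ k) := ⟨pow_ne_zero _ (Fact.out : p.Prime).ne_zero⟩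
  subgroupKummerUnitsRoot K (p ^ k) (F.V s) (u.z s) (u.smul_z s)

omit [NumberField K] in
/-- `(z_s^{1/p^k})^{p^k} = z_s`. [cite: Kato2004Asterisque, (15.6.1) (p. 253)] -/
@[simp] theorem root_pow (s k : ℕ) :
    ((F.root u s k : subgroupKummerUnits K (p ^ k) (F.V s)) : (AlgebraicClosure K)ˣ) ^ (p ^ k) = u.z s := by
  haveI : NeZero (p ^ k) := ⟨pow_ne_zero _ (Fact.out : p.Prime).ne_zero⟩
  exact subgroupKummerUnitsRoot_pow K (p ^ k) (F.V s) (u.z s) (u.smul_z s)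

/-- **The level-`(s, k)` class `κ_{V_s}(z_s^{1/p^k}) ∪ e_k ∈ H¹(V_s, E[p^k])`** (`k ≤ s`; T1b-1 `kummerCupLevelClass` at
`N = p^k`, `n = (p : ℤ)^k`). [cite: Kato2004Asterisque, (15.6.1) (p. 253) and (15.12.1) (p. 263)] -/
def levelClass (s k : ℕ) (hks : k ≤ s) : H1 (E.torsionGaloisModule ((p : ℤ) ^ k)) (F.V s) :=
  haveI : NeZero (p ^ k) := ⟨pow_ne_zero _ (Fact.out : p.Prime).ne_zero⟩
  kummerCupLevelClass E (p ^ k) (F.V s) (F.ζ k) (F.isPrimitiveRoot_ζ k) (Nat.cast_pow p k) (F.e k)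
    (F.smul_ζ k s hks) (F.smul_e k s hks) (F.root u s k)

/-! ## §2 Independence of the Kummer level; the classes on a bigger open subgroup -/

/-- **One step down the Kummer tower**: `Cor_{V_{s+1} → V_s}(κ_{V_{s+1}}(z_{s+1}^{1/p^k}) ∪ e_k) = κ_{V_s}(z_s^{1/p^k}) ∪ e_k`
(`k ≤ s`) — `cor ∘ κ = κ ∘ N` (T1b-1 `coresLe_kummerCupLevelClass_eq_of_pow_eq`) and the norm relation `N z_{s+1} = z_s`.
[cite: Kato2004Asterisque, §15.5 (p. 253)] [cite: NeukirchSchmidtWingberg2008, I §5 (1.5.7)] -/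
theorem layerCores_levelClass_succ (s k : ℕ) (hks : k ≤ s) :
    CM.layerCores (E.torsionGaloisModule ((p : ℤ) ^ k)) (F.V_succ_le s) (F.isOpen_V (s + 1))
        (F.levelClass u (s + 1) k (hks.trans (Nat.le_succ s))) = F.levelClass u s k hks := by
  haveI : NeZero (p ^ k) := ⟨pow_ne_zero _ (Fact.out : p.Prime).ne_zero⟩
  haveI : CompactSpace (absoluteGaloisGroup K) := absoluteGaloisGroup_compactSpace K
  haveI : (F.V (s + 1)).FiniteIndex := finiteIndex_of_isOpen_of_compactSpace _ (F.isOpen_V (s + 1))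
  letI : Fintype (F.V s ⧸ (F.V (s + 1)).subgroupOf (F.V s)) := Fintype.ofFinite _
  rw [layerCores_eq_coresLe]
  unfold levelClass
  refine coresLe_kummerCupLevelClass_eq_of_pow_eq E (p ^ k) (F.ζ k) (F.isPrimitiveRoot_ζ k) (Nat.cast_pow p k) (F.e k)
    (F.V_succ_le s) (F.isOpen_V (s + 1)) (s := Quotient.out) (fun x ↦ QuotientGroup.out_eq' x)
    (F.smul_ζ k s hks) (F.smul_e k s hks) (F.root u (s + 1) k) (F.root u s k) ?_
  simp only [root_pow]
  exact (u.norm_z s Quotient.out fun x ↦ QuotientGroup.out_eq' x).symm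

/-- **Down the Kummer tower**: `Cor_{V_{s'} → V_s}(levelClass s' k) = levelClass s k` for `k ≤ s < s'` (transitivity of `cor` +
the one-step case). [cite: Kato2004Asterisque, §15.5 (p. 253)] [cite: NeukirchSchmidtWingberg2008, I §5 Prop. 1.5.3 (iii)] -/
theorem layerCores_levelClass_of_lt (s k : ℕ) (hks : k ≤ s) {s' : ℕ} (h : s + 1 ≤ s') :
    CM.layerCores (E.torsionGaloisModule ((p : ℤ) ^ k)) (F.V_anti (Nat.le_of_succ_le h)) (F.isOpen_V s')
        (F.levelClass u s' k (hks.trans (Nat.le_of_succ_le h))) = F.levelClass u s k hks := by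
  induction s', h using Nat.le_induction with
  | base => exact F.layerCores_levelClass_succ u s k hks
  | succ s' h ih =>
      rw [← CM.layerCores_trans (E.torsionGaloisModule ((p : ℤ) ^ k)) (F.V_succ_le s') (F.V_anti (Nat.le_of_succ_le h))
        (F.isOpen_V (s' + 1)) (F.isOpen_V s'), F.layerCores_levelClass_succ u s' k (hks.trans (Nat.le_of_succ_le h)), ih]

/-- ★ **The class on a bigger open subgroup `U ⊇ V_s`: `c_{U,k} = Cor_{V_s → U}(κ_{V_s}(z_s^{1/p^k}) ∪ e_k) ∈ H¹(U, E[p^k])`**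
(`k ≤ s`; at a layer `U = Gal(K̄/K')`, `K' ⊆ K(p^s𝔣)`, this is the value at `(K', k)` of Kato's (15.6.1)∘(15.12.1) on the unit
tower). [cite: Kato2004Asterisque, (15.6.1) (p. 253), (15.12.1) (p. 263), 15.14 (p. 264)] -/
def classAt (U : Subgroup (absoluteGaloisGroup K)) (s k : ℕ) (hks : k ≤ s) (hsU : F.V s ≤ U) :
    H1 (E.torsionGaloisModule ((p : ℤ) ^ k)) U :=
  CM.layerCores (E.torsionGaloisModule ((p : ℤ) ^ k)) hsU (F.isOpen_V s) (F.levelClass u s k hks)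

/-- **Independence of the Kummer level**: `c_{U,k}` does not depend on the auxiliary `s` (`Cor` is transitive and
`Cor_{V_{s'}→V_s}(levelClass s') = levelClass s`). [cite: Kato2004Asterisque, §15.5 (p. 253)] [cite:
NeukirchSchmidtWingberg2008, I §5 Prop. 1.5.3 (iii)] -/
theorem classAt_eq_of_le (U : Subgroup (absoluteGaloisGroup K)) {s s' : ℕ} (k : ℕ) (hks : k ≤ s) (hss' : s ≤ s')
    (hsU : F.V s ≤ U) :
    F.classAt u U s' k (hks.trans hss') ((F.V_anti hss').trans hsU) = F.classAt u U s k hks hsU := by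
  rcases Nat.eq_or_lt_of_le hss' with rfl | hlt
  · rfl
  · rw [classAt, classAt, ← F.layerCores_levelClass_of_lt u s k hks hlt, CM.layerCores_trans]

/-- `c_{U,k}` for two admissible auxiliary levels coincide. [cite: Kato2004Asterisque, §15.5 (p. 253)] -/
theorem classAt_eq_classAt (U : Subgroup (absoluteGaloisGroup K)) {s s' : ℕ} (k : ℕ) (hks : k ≤ s) (hks' : k ≤ s')
    (hsU : F.V s ≤ U) (hs'U : F.V s' ≤ U) :
    F.classAt u U s k hks hsU = F.classAt u U s' k hks' hs'U := by
  rcases le_total s s' with h | h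
  · exact (F.classAt_eq_of_le u U k hks h hsU).symm
  · exact F.classAt_eq_of_le u U k hks' h hs'U

/-- **Transitivity**: `Cor_{U → U'} c_{U,k} = c_{U',k}` for open `U ≤ U'`. [cite: Kato2004Asterisque, §15.5 (p. 253)]
[cite: NeukirchSchmidtWingberg2008, I §5 Prop. 1.5.3 (iii)] -/
theorem layerCores_classAt {U U' : Subgroup (absoluteGaloisGroup K)} (hUU' : U ≤ U')
    (hU : IsOpen (U : Set (absoluteGaloisGroup K))) (s k : ℕ) (hks : k ≤ s) (hsU : F.V s ≤ U) :
    CM.layerCores (E.torsionGaloisModule ((p : ℤ) ^ k)) hUU' hU (F.classAt u U s k hks hsU) =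
      F.classAt u U' s k hks (hsU.trans hUU') := by
  rw [classAt, classAt, CM.layerCores_trans]

/-- ★ **Compatibility in `k` (`p_*`)**: `p_* c_{U,k+1} = c_{U,k}` — `p_*` commutes with `cor`
(`reduceTorsionH1_layerCoresK`) and
`p_*(κ(z^{1/p^{k+1}}) ∪ e_{k+1}) = κ((z^{1/p^{k+1}})^p) ∪ e_k = κ(z^{1/p^k}) ∪ e_k` (T1b-1
`mapH1AddHom_kummerCupLevelClass_of_pow` with
`ζ_{k+1}^p = ζ_k`, `p e_{k+1} = e_k`, then root-independence). [cite: Kato2004Asterisque, §8.2 (p. 181) and (15.12.1) (p. 263)]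
[cite: Rubin2000, App. B Prop. B.2.3] -/
theorem reduceTorsionH1_classAt (U : Subgroup (absoluteGaloisGroup K)) (s k : ℕ) (hks : k + 1 ≤ s) (hsU : F.V s ≤ U) :
    E.reduceTorsionH1 p k U (F.classAt u U s (k + 1) hks hsU) = F.classAt u U s k (Nat.le_of_succ_le hks) hsU := by
  haveI : NeZero (p ^ k) := ⟨pow_ne_zero _ (Fact.out : p.Prime).ne_zero⟩
  haveI : NeZero (p ^ (k + 1)) := ⟨pow_ne_zero _ (Fact.out : p.Prime).ne_zero⟩
  have hk : k ≤ s := Nat.le_of_succ_le hks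
  rw [classAt, classAt, reduceTorsionH1_layerCoresK]
  congr 1
  rw [reduceTorsionH1_eq_mapH1AddHomK, levelClass, levelClass,
    mapH1AddHom_kummerCupLevelClass_of_pow E (p ^ k) (F.V s) (F.ζ k) (F.isPrimitiveRoot_ζ k)
      (Nat.cast_pow p k) (F.e k) (F.smul_ζ k _ hk) (F.smul_e k _ hk) p (pow_succ p k).symm (F.ζ (k + 1))
      (F.isPrimitiveRoot_ζ (k + 1)) (F.ζ_succ_pow k) (Nat.cast_pow p (k + 1)) (F.e (k + 1)) (F.e_succ k)
      (F.smul_ζ (k + 1) _ hks) (F.smul_e (k + 1) _ hks) (E.geomTorsionReduce p k)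
      (fun P ↦ E.coe_geomTorsionReduce p k P) (geomTorsionReduce_subgroupRepK E p k _) (F.root u s (k + 1))]
  refine kummerCupLevelClass_eq_of_pow_eq E (p ^ k) _ (F.ζ k) (F.isPrimitiveRoot_ζ k) (Nat.cast_pow p k) (F.e k) _ _ ?_
  change (((F.root u s (k + 1) : subgroupKummerUnits K (p ^ (k + 1)) _) : (AlgebraicClosure K)ˣ) ^ p) ^ p ^ k = _
  rw [← pow_mul, ← pow_succ', root_pow, root_pow]

/-- ★ **Integrality**: `c_{U,k} ∈ H¹(O_{K̄^U}[1/p], E[p^k]) = CM.integralH1K (E.torsionGaloisModule (p^k)) p U` — the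
Kummer–cup class
of a root of the `p`-unit `z_s` is unramified at every `𝔓 ∤ p` (T1b-1 `kummerCupLevelClass_mem_integralH1K`, fed by field
`punit_z` with co-factor `c = p^m`: `p^m z_s^{1/p^k}` is an algebraic integer outside `𝔓`), and `cor` preserves integrality
(`coresLe_mem_integralH1K_of_le`, Mackey). [cite: Kato2004Asterisque, §15.5–15.6 (p. 253) and §8.2, Lemma 8.5 (pp. 180–184)]
[cite: Lang1983, Ch. 6 Prop. 1.3] -/
theorem classAt_mem_integralH1K (U : Subgroup (absoluteGaloisGroup K)) (s k : ℕ) (hks : k ≤ s) (hsU : F.V s ≤ U) :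
    F.classAt u U s k hks hsU ∈ integralH1K (E.torsionGaloisModule ((p : ℤ) ^ k)) p U := by
  have hp : p.Prime := Fact.out
  haveI : NeZero (p ^ k) := ⟨pow_ne_zero _ hp.ne_zero⟩
  haveI : CompactSpace (absoluteGaloisGroup K) := absoluteGaloisGroup_compactSpace K
  haveI : (F.V s).FiniteIndex := finiteIndex_of_isOpen_of_compactSpace _ (F.isOpen_V _)
  letI : Fintype (U ⧸ (F.V s).subgroupOf U) := Fintype.ofFinite _
  rw [classAt, layerCores_eq_coresLe]
  refine coresLe_mem_integralH1K_of_le _ p _ _ ?_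
  unfold levelClass
  refine kummerCupLevelClass_mem_integralH1K E (F.V s) p k (F.ζ k) (F.isPrimitiveRoot_ζ k) (Nat.cast_pow p k)
    (F.e k) _ _ (F.root u s k) fun v hv 𝔓 h𝔓 ↦ ?_
  obtain ⟨m, a, ha, ha𝔓⟩ := u.punit_z s
  haveI : 𝔓.IsPrime := (HeightOneSpectrum.mem_primesAbove_iff.mp h𝔓).1
  haveI : 𝔓.LiesOver v.asIdeal := (HeightOneSpectrum.mem_primesAbove_iff.mp h𝔓).2
  -- `p ∉ 𝔓` (𝔓 lies over `v ∌ p`)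
  have hq : ((p : absIntegers (𝓞 K) K) : AlgebraicClosure K) = (p : AlgebraicClosure K) :=
    map_natCast (absIntegers (𝓞 K) K).val p
  have hp𝔓 : (p : absIntegers (𝓞 K) K) ∉ 𝔓 := by
    intro hmem
    have h1 : algebraMap (𝓞 K) (absIntegers (𝓞 K) K) (p : 𝓞 K) ∈ 𝔓 := by rwa [map_natCast]
    rw [← Ideal.mem_comap, ← Ideal.under_def, ← Ideal.LiesOver.over (P := 𝔓) (p := v.asIdeal)] at h1
    exact hv h1
  have hp0 : (p : AlgebraicClosure K) ≠ 0 := by exact_mod_cast hp.ne_zero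
  -- the co-factor `c = p^m ∈ K`, fixed by `Γ_K`
  let c : (AlgebraicClosure K)ˣ := Units.mk0 ((p : AlgebraicClosure K) ^ m) (pow_ne_zero m hp0)
  have hcfix : ∀ σ : absoluteGaloisGroup K, σ • c = c := fun σ ↦ Units.ext (by
    rw [Units.coe_smul]
    change σ • ((p : AlgebraicClosure K) ^ m) = (p : AlgebraicClosure K) ^ m
    rw [smul_pow', ← map_natCast (algebraMap K (AlgebraicClosure K)) p, smul_algebraMap])
  let cU : subgroupKummerUnits K (p ^ k) (F.V s) := ⟨c, mem_subgroupKummerUnits_of_forall_smul_eq fun σ ↦ hcfix σ⟩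
  -- `(z_s^{1/p^k} · p^m)^{p^k} = a · p^{m (p^k - 1)}` is an algebraic integer outside `𝔓`
  have hks1 : 1 ≤ p ^ k := Nat.one_le_pow k p hp.pos
  have hexp : m * p ^ k = m + m * (p ^ k - 1) := by
    rw [Nat.mul_sub, mul_one, Nat.add_sub_cancel' (Nat.le_mul_of_pos_right m hks1)]
  have hpow : (((F.root u s k * cU : subgroupKummerUnits K (p ^ k) (F.V s)) : (AlgebraicClosure K)ˣ) : AlgebraicClosure K) ^
      (p ^ k) = (a : AlgebraicClosure K) * (p : AlgebraicClosure K) ^ (m * (p ^ k - 1)) := by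
    rw [Subgroup.coe_mul, Units.val_mul, mul_pow, ← Units.val_pow_eq_pow_val, F.root_pow, ha]
    change (u.z s : AlgebraicClosure K) * ((p : AlgebraicClosure K) ^ m) ^ (p ^ k) = _
    rw [← pow_mul, hexp, pow_add]
    ring
  have hint : IsIntegral (𝓞 K) ((((F.root u s k * cU : subgroupKummerUnits K (p ^ k) (F.V s)) : (AlgebraicClosure K)ˣ) :
      AlgebraicClosure K)) := by
    refine IsIntegral.of_pow hks1 ?_
    rw [hpow, ← hq]
    exact a.2.mul ((p : absIntegers (𝓞 K) K) ^ (m * (p ^ k - 1))).2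
  refine ⟨cU, fun σ ↦ hcfix σ, ⟨_, hint⟩, rfl, fun hα ↦ ?_⟩
  have h1 := Ideal.pow_mem_of_mem 𝔓 hα (p ^ k) hks1
  have h2 : (⟨_, hint⟩ : absIntegers (𝓞 K) K) ^ (p ^ k) = a * (p : absIntegers (𝓞 K) K) ^ (m * (p ^ k - 1)) :=
    Subtype.ext (by
      rw [SubmonoidClass.coe_pow, Subalgebra.coe_mul, SubmonoidClass.coe_pow, hq]
      exact hpow)
  rw [h2] at h1
  rcases ‹𝔓.IsPrime›.mem_or_mem h1 with h | h
  · exact ha𝔓 v hv 𝔓 h𝔓 h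
  · exact hp𝔓 (‹𝔓.IsPrime›.mem_of_pow_mem _ h)

/-! ## §3 The classes on the cyclotomic layers `K_n` of a `ℤ_p`-extension `κ` and their Λ-adic glueing -/

section Cyclotomic

variable (κ : ZpExtension K p)

omit [NumberField K] in
/-- `V s ≤ Gal(K̄/K_n)` for `n + 1 ≤ s`, granted (b2) `V (n+1) ≤ Gal(K̄/K_n)` (`K_n ⊆ K(p^{n+1}𝔣)`).
[cite: Kato2004Asterisque, 15.14 (p. 264)] -/
theorem V_le_layer (hV : ∀ n, F.V (n + 1) ≤ κ.layerSubgroup n) (n : ℕ) {s : ℕ} (h : n + 1 ≤ s) :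
    F.V s ≤ κ.layerSubgroup n :=
  (F.V_anti h).trans (hV n)

/-- The auxiliary Kummer level used to define the class on `K_n` modulo `p^k`: `s₀(n, k) = max (n+1) k`.
[cite: Kato2004Asterisque, 15.14 (p. 264)] -/
def level (n k : ℕ) : ℕ := max (n + 1) k

/-- `k ≤ s₀(n, k)`. [cite: Kato2004Asterisque, 15.14 (p. 264)] -/
theorem le_level (n k : ℕ) : k ≤ level n k := le_max_right _ _

/-- `n + 1 ≤ s₀(n, k)`. [cite: Kato2004Asterisque, 15.14 (p. 264)] -/
theorem succ_le_level (n k : ℕ) : n + 1 ≤ level n k := le_max_left _ _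

/-- ★ **The class on the cyclotomic layer: `c_{n,k} = Cor_{V_{s₀} → Gal(K̄/K_n)}(κ_{V_{s₀}}(z_{s₀}^{1/p^k}) ∪ e_k) ∈
H¹(K_n, E[p^k])`**,
`s₀ = max (n+1) k`, granted (b2) `hV : V (n+1) ≤ Gal(K̄/K_n)` — the value at level `(n, k)` of Kato's
(15.6.1)∘(15.12.1)∘15.14 on the
unit tower `(z_s)`. [cite: Kato2004Asterisque, (15.6.1) (p. 253), (15.12.1) (p. 263), 15.14 (p. 264)] -/
def cycClass (hV : ∀ n, F.V (n + 1) ≤ κ.layerSubgroup n) (n k : ℕ) : H1 (E.torsionGaloisModule ((p : ℤ) ^ k)) (κ.layerSubgroup n) :=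
  F.classAt u (κ.layerSubgroup n) (level n k) k (le_level n k) (F.V_le_layer κ hV n (succ_le_level n k))

/-- `c_{n,k}` computed from ANY admissible Kummer level `s` (`k ≤ s`, `n + 1 ≤ s`).
[cite: Kato2004Asterisque, §15.5 (p. 253) and 15.14 (p. 264)] -/
theorem cycClass_eq_classAt (hV : ∀ n, F.V (n + 1) ≤ κ.layerSubgroup n) (n k s : ℕ) (hks : k ≤ s) (hns : n + 1 ≤ s) :
    F.cycClass u κ hV n k = F.classAt u (κ.layerSubgroup n) s k hks (F.V_le_layer κ hV n hns) :=
  F.classAt_eq_classAt u _ k _ _ _ _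

/-- ★ **Compatibility in `n` (trace maps)**: `Cor_{K_{n+1}/K_n} c_{n+1,k} = c_{n,k}` — both are the corestriction from a common
Kummer level (transitivity of `cor`). [cite: Kato2004Asterisque, §12.2 (p. 220) and §15.5 (p. 253)] [cite: Rubin2000,
III §3.4] -/
theorem layerCoresOver_cycClass (hV : ∀ n, F.V (n + 1) ≤ κ.layerSubgroup n) (n k : ℕ) :
    layerCoresOver (E.torsionGaloisModule ((p : ℤ) ^ k)) κ n (F.cycClass u κ hV (n + 1) k) = F.cycClass u κ hV n k := by
  rw [layerCoresOver_eq_layerCores, cycClass, F.layerCores_classAt,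
    F.cycClass_eq_classAt u κ hV n k (level (n + 1) k) (le_level _ _) ((Nat.le_succ _).trans (succ_le_level _ _))]

/-- ★ **Compatibility in `k` (`p_*`)**: `p_* c_{n,k+1} = c_{n,k}`. [cite: Kato2004Asterisque, §8.2 (p. 181) and
(15.12.1) (p. 263)]
[cite: Rubin2000, App. B Prop. B.2.3] -/
theorem reduceTorsionH1_cycClass (hV : ∀ n, F.V (n + 1) ≤ κ.layerSubgroup n) (n k : ℕ) :
    E.reduceTorsionH1 p k (κ.layerSubgroup n) (F.cycClass u κ hV n (k + 1)) = F.cycClass u κ hV n k := by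
  rw [cycClass, F.reduceTorsionH1_classAt,
    F.cycClass_eq_classAt u κ hV n k (level n (k + 1)) ((Nat.le_succ k).trans (le_level _ _)) (succ_le_level _ _)]

/-- ★ **Integrality**: `c_{n,k} ∈ H¹(O_{K_n}[1/p], E[p^k])`. [cite: Kato2004Asterisque, §15.5–15.6 (p. 253) and §8.2
(pp. 180–181)] -/
theorem cycClass_mem_integralH1K (hV : ∀ n, F.V (n + 1) ≤ κ.layerSubgroup n) (n k : ℕ) :
    F.cycClass u κ hV n k ∈ integralH1K (E.torsionGaloisModule ((p : ℤ) ^ k)) p (κ.layerSubgroup n) :=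
  F.classAt_mem_integralH1K u _ _ k _ _

/-- ★★ **Kato's Λ-adic class of a unit tower on a Kummer frame** ((15.6.1)∘(15.12.1)∘15.14 followed by `𝐇¹_{K,Γ}(T_pE) =
lim←_{n,k} H¹(O_{K_n}[1/p], E[p^k])`): there is a UNIQUE element `x` of the pinned Iwasawa cohomology `IK.H` whose
reduction modulo
`p^k` at the layer `K_n` is `c_{n,k} = Cor(κ(z_s^{1/p^k}) ∪ e_k)` for all `n, k` (T2b-2
`IwasawaH1DataOver.existsUnique_of_compatible`
fed by the three compatibilities above).  At the consumer (`p = 7`, `K = ℚ(√−7)`, `z s = _𝔞z_{7^s𝔣}`) this `x` is the Λ-adic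
elliptic-unit class `EU 𝔞` constrained by the field `EU_not_mem_of_residue` of `GenusSeven.KatoGenusFrame`.
[cite: Kato2004Asterisque, §8.2 (p. 181), §12.2 (p. 220), (15.12.1) (p. 263), 15.14 (p. 264)] [cite: Rubin2000, App. B Prop. B.2.3, §B.3] -/
theorem existsUnique_iwasawaClass (hV : ∀ n, F.V (n + 1) ≤ κ.layerSubgroup n) [E.IsElliptic] [ContinuousSMul ℤ_[p] (E.tateModule p)]
    {γ : absoluteGaloisGroup K} (IK : IwasawaH1DataOver E p κ γ) :
    ∃! x : IK.H, ∀ n k, reduceH1PkK E p k (κ.layerSubgroup n) (IK.proj n x) = F.cycClass u κ hV n k :=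
  IwasawaH1DataOver.existsUnique_of_compatible E p IK (fun n k ↦ F.cycClass u κ hV n k)
    (fun n k ↦ F.reduceTorsionH1_cycClass u κ hV n k) (fun n k ↦ F.layerCoresOver_cycClass u κ hV n k)
    (fun n k ↦ F.cycClass_mem_integralH1K u κ hV n k)

end Cyclotomic

end KummerFrame

end Literature.NumberTheory.EllipticCurves.Kato2004

end
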